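import Summits.Ventures.HodgeRepro2.T5SU11KernelNeumannGlobal
import Summits.Ventures.HodgeRepro2.T5SU11KernelCompositionCornerAll

/-!
# Summary XXXIV — the global uniform convergence of the kernel's Neumann tail and the corner values of all composed kernels
(rows 652–653), under uniform names

* `neumann_tail_uniform_global`, `neumann_tail_remainder` — **`Σ_{n<N} (μ − μ₂)^{n+1} K_{λ₂}^{∘(n+2)} → K_λ − K_{λ₂}` uniformly on
  `(0, ∞)²`, with the remainder `C |μ − μ₂| ρ^N/(1 − ρ)`** (row 652);
* `kernel_comp_corner_all` — **every composed kernel beyond the first extends continuously to the corner** (row 653).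

Nothing is claimed about (N).

Blind lane: Mathlib + the HodgeRepro2 prefix only; no sorry; axioms ⊆ {propext, Classical.choice,
Quot.sound}.
-/

namespace Summit.Ventures.HodgeRepro2.T5SU11RadialSummaryXXXIV

open Filter Topology MeasureTheory
open Set (Ioi)
open T5SU11Cartan T5SU11SphericalFunction T5SU11SphericalDecay T5SU11RadialGreenKernel T5SU11RadialGreenImproper
  T5SU11KernelNeumannGlobal T5SU11KernelCompositionCornerAll

section measure

variable [MeasurableSpace Circle] [BorelSpace Circle]

variable {lam lam₂ : ℝ} (hlam : 1 < lam) (hlam₂ : 1 < lam₂)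

include hlam hlam₂ in
/-- **The kernel's Neumann tail converges uniformly on the whole quadrant** (row 652). -/
theorem neumann_tail_uniform_global (hq : |lam * (lam - 2) - lam₂ * (lam₂ - 2)| < (lam₂ - 1) ^ 2) :
    TendstoUniformlyOn
      (fun N : ℕ => fun p : ℝ × ℝ => ∑ n ∈ Finset.range N, (lam * (lam - 2) - lam₂ * (lam₂ - 2)) ^ (n + 1)
        * ((greenSolI (fun t => sph lam₂ (hyp t)) (sphDecay lam₂))^[n + 1] (fun r => sphGreenKernel lam₂ r p.2)) p.1)
      (fun p : ℝ × ℝ => sphGreenKernel lam p.1 p.2 - sphGreenKernel lam₂ p.1 p.2) atTop (Ioi 0 ×ˢ Ioi 0) :=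
  tendstoUniformlyOn_kernel_sub_neumann hlam hlam₂ hq

include hlam hlam₂ in
/-- **The explicit uniform remainder of the kernel's Neumann tail** (row 652). -/
theorem neumann_tail_remainder (hq : |lam * (lam - 2) - lam₂ * (lam₂ - 2)| < (lam₂ - 1) ^ 2) :
    ∃ C : ℝ, 0 < C ∧ ∀ N : ℕ, ∀ t s, 0 < t → 0 < s →
      |sphGreenKernel lam t s - sphGreenKernel lam₂ t s
        - ∑ n ∈ Finset.range N, (lam * (lam - 2) - lam₂ * (lam₂ - 2)) ^ (n + 1)
          * ((greenSolI (fun t => sph lam₂ (hyp t)) (sphDecay lam₂))^[n + 1] (fun r => sphGreenKernel lam₂ r s)) t|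
        ≤ C * |lam * (lam - 2) - lam₂ * (lam₂ - 2)|
          * (|lam * (lam - 2) - lam₂ * (lam₂ - 2)| / (lam₂ - 1) ^ 2) ^ N
          / (1 - |lam * (lam - 2) - lam₂ * (lam₂ - 2)| / (lam₂ - 1) ^ 2) :=
  abs_kernel_sub_partial_sum_le hlam hlam₂ hq

include hlam in
/-- **Every composed kernel beyond the first extends continuously to the corner** (row 653). -/
theorem kernel_comp_corner_all (n : ℕ) :
    Tendsto (fun p : ℝ × ℝ =>
        ((greenSolI (fun t => sph lam (hyp t)) (sphDecay lam))^[n + 2] (fun u => sphGreenKernel lam u p.2)) p.1)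
      (𝓝[>] 0 ×ˢ 𝓝[>] 0)
      (𝓝 (∫ r in Ioi 0, sphDecay lam r
        * (∫ u in Ioi 0, sphDecay lam u
            * ((greenSolI (fun t => sph lam (hyp t)) (sphDecay lam))^[n] (fun v => sphGreenKernel lam v r)) u
            * Real.sinh (2 * u))
        * Real.sinh (2 * r))) :=
  tendsto_kernel_comp_corner_all hlam n

end measure

end Summit.Ventures.HodgeRepro2.T5SU11RadialSummaryXXXIV
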